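import Summits.BirchSwinnertonDyer.Rank1Residual.X2.LambdaMinimal
import Summits.BirchSwinnertonDyer.Rank1Residual.X1.RankOneParitySqueeze
import HarnessLib

/-!
# Class X2 (odd multiplicative Eisenstein prime), sub-cell X2c (rank one): what `μ_an = 0 ∧ λ_an = 1 + e`
# gives BEYOND the main conjecture — Schneider non-degeneracy of THE Stein–Wuthrich height, the EXACT
# `Ш`-valuation identity, and `BSD(E,p) ⟺ one p-adic regulator valuation`
# (cell `b2b-bsdres`, unit `b2b-bsdres-eisenstein-p2`, gen 5)

HONEST FRAMING (run/shared/lean/b2b/bsd-rank1-residual/, verbatim in every file): the goal of the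
cell is to DELETE the COMBINATION-SHAPED residual classes of the Birch–Swinnerton-Dyer formula for
ALL analytic-rank `≤ 1` elliptic curves over `ℚ` — "full BSD formula for every rank `≤ 1` curve in
class `C`" assembled STRICTLY from published theorems — so that the rank-`≤ 1` remainder becomes
exactly the CONSTRUCTION-SHAPED classes, which are TYPED (missing-input `Prop`s), NOT attempted.
This is not "finishing BSD". Research route; NO CLAIM BEYOND STATED CLASSES; nothing here changes
a label; X2c stays CONSTRUCTION-SHAPED (its class-level input is `X2.HeegnerIndexIdentity`,
`X2/RankOneHeegnerExact.lean`). Theorems only (no definition, no new named fact): the published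
theorems enter as the tree's existing NAMED FACTS, taken as hypotheses; the per-pair data are gen 4's
typed finite checks `X2.AnalyticMuLE` / `X2.AnalyticLambdaEq` and ONE valuation.

WHY THIS FILE. Gen 4's `X2/LambdaMinimal.lean` (`mazurMainConjectureAt_of_lamMin`) reads Mazur's
main conjecture at an X2c pair off the two finite checks `μ_an = 0`, `λ_an = 1 + e` (`e = 1` at a
split, `0` at a non-split prime; iw-2 census, N < 2·10⁴, two engines: 491 of the 705 X2c pairs) and
stops there: "`BSD(E,p)` at such a pair still needs the `p`-adic regulator (lever L3)". This file
says exactly HOW MUCH of the regulator is needed, and what comes for free: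

* **Schneider's conjecture at the pair** (`schneider_and_shaIdentity_of_lamMin_{split,nonsplit}`,
  first conjunct). The squeeze gives `λ(f_E) = 1` and `μ(f_E) = 0` for a generator `f_E` of
  `char_Λ X(E/ℚ_∞)`; Jones' clause (1) `T^{rank E(ℚ)} ∣ f_E` (Stein–Wuthrich 2013 Thm. 6.1,
  `rank = 1` by Gross–Zagier–Kolyvagin) and `ord_T f_E ≤ λ(f_E)` give `ord_T f_E = 1 = rank`, so by
  clause (2) THE §4.2 `p`-adic height (`IsSplitMultCanonical` / `IsMultCanonical`) is
  NON-DEGENERATE: `Reg_p(E, Dh) ≠ 0`. Instances of Schneider's conjecture at multiplicative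
  Eisenstein primes from two finite `p`-adic checks — no height is computed.
* **The exact `Ш`-valuation identity** (second conjunct). Clause (3) with `[T¹]f_E ∈ ℤ_pˣ`
  (`[T^{λ}]f_E = p^{μ}·unit`), `ord_p log_p κ(γ) = 1`, `ε_p = 2 ∈ ℤ_pˣ` reads, in `ℤ`:
  non-split: `ord_p #Ш(E/ℚ)[p^∞] + ord_p Reg_p(E,Dh) + ord_p ∏c_ℓ = 1 + 2·ord_p #E(ℚ)_tors`;
  split:     `ord_p #Ш(E/ℚ)[p^∞] + ord_p 𝓛_p + ord_p Reg_p(E,Dh) + ord_p ∏c_ℓ = 2 + 2·ord_p #E(ℚ)_tors`.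
  So `#Ш[p^∞]` is DETERMINED by one integer, `ord_p Reg_p` (and, at a split prime, gen 4's
  two-engine `ord_p 𝓛_p = ord_p log_p q_E − ord_p c_p`); and a priori (§3)
  `ord_p Reg_p ≤ 1 + e + 2·ord_p #tors − e·ord_p 𝓛_p − ord_p ∏c_ℓ`
  (`regulatorValuation_le_of_lamMin_{split,nonsplit}`).
* Companion file `X2/RankOneRegulatorBSD.lean`: hence **`BSD(E,p) ⟺ ord_p Reg_p(E,Dh) = 1 + e +
  2·ord_p #tors − e·ord_p 𝓛_p − ord_p ∏c_ℓ − ord_p #Ш_an`** — lever L3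
  (`Typed.X2.bsdp_of_thm16mult_*_of_canonical_certificate`) with its `p`-adic `L`-series data
  (`hordL`, the leading coefficient `[T^{1+e}](ϖL)` to precision, `p ∤ #Ш_an`) REPLACED by the
  already-certified bits `(μ_an, λ_an) = (0, 1+e)`; ONE valuation of ONE height remains, and it is
  NECESSARY as well as sufficient.

What this is NOT: a class theorem; a new route (it is lamMin ∘ Jones, per pair); a claim about the
491 pairs (booking needs iw-1/iw-2's two-engine `(μ, λ)` table, R93.3, and a two-engine `ord_p Reg_p`).

References: [SteinWuthrich2013] Thm. 6.1 (p. 20), §3.1 (p. 9), §4.2 (pp. 15–16), §4.4 (p. 18);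
[Wuthrich2014] Thm. 16; [GreenbergVatsal2000] (1)–(2), p. 4; [Schneider1982PadicHeightI] §1;
[MazurTateTeitelbaum1986] §II.4–II.5; [Miller2011LMS] Def. 1.1; HOME/b2b-bsdres-eisenstein-p2/X2-GAP.md §10.
-/

set_option autoImplicit false

noncomputable section

open scoped Classical MatrixGroups ModularForm

open PowerSeries CongruenceSubgroup WeierstrassCurve Literature.NumberTheory.EllipticCurves
  Literature.NumberTheory.EllipticCurves.ModularForms
  Literature.NumberTheory.EllipticCurves.Rank1Residual
  Literature.NumberTheory.EllipticCurves.Rank1Residual.Typed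
  Literature.NumberTheory.EllipticCurves.Wuthrich2014
  Literature.NumberTheory.EllipticCurves.SteinWuthrich2013
  Summit.BirchSwinnertonDyer.Rank1Residual.X1.MuLambda
  Summit.BirchSwinnertonDyer.Rank1Residual.X1.MuPart
  Summit.BirchSwinnertonDyer.Rank1Residual.X1.ParitySqueeze
  Summit.BirchSwinnertonDyer.Rank1Residual.X1.RankOneParitySqueeze

namespace Summit.BirchSwinnertonDyer.Rank1Residual.X2

/-! ## §1. The λ-minimal datum: `λ(f_E) = 1`, `μ(f_E) = 0`, `ord_T f_E = 1` -/

section Datum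

variable {p : ℕ} [Fact p.Prime]

/-- **`ord_T f = 1` from `λ(f) = 1` and `1 ≤ ord_T f`** (`ord_T f ≤ λ(f)` for `f ≠ 0`).
[cite: Washington1997, §7.1] -/
theorem order_eq_one_of_lam_eq_one {f : IwasawaAlgebra p} (hf : f ≠ 0) (hlam : lam f = 1)
    (h1 : ((1 : ℕ) : ℕ∞) ≤ f.order) : f.order = ((1 : ℕ) : ℕ∞) := by
  refine le_antisymm ?_ h1
  have e := order_le_lam hf
  rwa [hlam] at e

/-- **`[T¹] f ∈ ℤ_pˣ` (as an element of `ℚ_p`: nonzero of valuation `0`) when `λ(f) = 1`, `μ(f) = 0`.**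
[cite: Washington1997, §7.1] -/
theorem valuation_coeff_one_eq_zero {f : IwasawaAlgebra p} (hf : f ≠ 0) (hlam : lam f = 1)
    (hμ : mu f = 0) :
    ((coeff 1 f : ℤ_[p]) : ℚ_[p]) ≠ 0 ∧ (((coeff 1 f : ℤ_[p]) : ℚ_[p])).valuation = 0 := by
  have h := valuation_coeff_lam hf
  rw [hlam, hμ] at h
  exact_mod_cast h

end Datum

/-! ## §2. Schneider non-degeneracy and the exact `Ш`-valuation identity at a λ-minimal X2c pair -/

section LamMin

variable {W : WeierstrassCurve ℚ} [W.IsElliptic] [W.IsGloballyMinimal] {p : ℕ} [Fact p.Prime]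

/-- **SPLIT multiplicative `p`: `μ_an = 0 ∧ λ_an = 2` at a rank-one pair ⇒ Schneider's conjecture for
THE Stein–Wuthrich §4.2 height and the exact `Ш`-valuation identity.** Data: `W/ℚ` globally minimal
elliptic, `p ≠ 2`, `E[p]` reducible, `ord_{s=1}L(E,s) = 1`, `Dq` the Tate parameter datum (split
multiplicative reduction), `Dh` THE §4.2 height (`IsSplitMultCanonical Dh Dq`). PUBLISHED named facts
(hypotheses): Wuthrich 2014 Thm. 16 (`hWu`), Stein–Wuthrich 2013 Thm. 6.1 split (`hJs`, all three
clauses), Gross–Zagier–Kolyvagin (`hGZK`), modular parametrisation (`hpar`, to instantiate the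
newform and `ϖ`). Per-pair data: `AnalyticMuLE W p 0`, `AnalyticLambdaEq W p 2`. Conclusion:
`Reg_p(E,Dh) ≠ 0` and
`ord_p #Ш(E/ℚ)[p^∞] + ord_p 𝓛_p + ord_p Reg_p(E,Dh) + ord_p ∏c_ℓ = 2 + 2·ord_p #E(ℚ)_tors`.
[cite: SteinWuthrich2013, Thm. 6.1 (p. 20), eq. (3.4) (p. 11), §4.2 (p. 16), §4.4 (p. 18)]
[cite: Wuthrich2014, Thm. 16 and §5 (p. 397)] [cite: GreenbergVatsal2000, p. 4 (after Thm. (1.2))]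
[cite: Schneider1982PadicHeightI, §1] -/
theorem schneider_and_shaIdentity_of_lamMin_split
    (hWu : thm16_charIdeal_dvd_multiplicative_of_reducible) (hJs : thm61_splitMultiplicative)
    (hGZK : rank_eq_analyticRank_of_analyticRank_le_one) (hpar : nonempty_modularParametrizationData)
    (W : WeierstrassCurve ℚ) [W.IsElliptic] [W.IsGloballyMinimal] (p : ℕ) [Fact p.Prime]
    (hp2 : p ≠ 2) (hred : ¬ W.HasIrreducibleModPGaloisRep p) (hr : W.analyticRank = 1)
    (Dq : TateParameterData W p) {Dh : PAdicHeightData W p} (hDh : IsSplitMultCanonical Dh Dq)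
    (hμ0 : AnalyticMuLE W p 0) (hlam : AnalyticLambdaEq W p 2) :
    SchneiderConjecture Dh ∧
      (padicValNat p (Nat.card (AddCommGroup.primaryComponent W.sha p)) : ℤ) +
          (LInvariant Dq).valuation + (padicRegulator Dh).valuation +
          padicValNat p W.tamagawaProduct =
        2 + 2 * padicValNat p W.torsionOrder := by
  have hpP : p.Prime := Fact.out
  have hsplit : W.HasSplitMultiplicativeReductionAtPrime p := Dq.split
  have hmult : W.HasMultiplicativeReductionAtPrime p := hsplit.hasMultiplicativeReductionAtPrime
  -- instantiate the data of Wuthrich's theorem: `(κ, γ)`, `X(E/ℚ_∞)`, the newform, `ϖ`, THE MTT function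
  obtain ⟨κ, hκ, γ, hγ, hγ'⟩ := exists_isCyclotomic_isTopGenerator_isCyclotomicVariable_holds p
  obtain ⟨D⟩ := W.nonempty_selmerDualData_holds κ γ hγ
  haveI : NeZero (W.conductorNorm ℤ) := ⟨(W.conductorNorm_pos_holds).ne'⟩
  obtain ⟨Dm⟩ := hpar W
  obtain ⟨ϖ, -, hϖ, -⟩ := Dm.exists_rat_mul_realPeriodRat_eq_plusPeriod
  haveI : Module.Finite (IwasawaAlgebra p) D.X := D.module_finite_holds hγ
  obtain ⟨hX, -, hKs⟩ := hWu W p hp2 hmult hred hκ hγ hγ' Dm.isNewformOf D ϖ hϖ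
  haveI : (Literature.NumberTheory.EllipticCurves.Module.charIdeal (IwasawaAlgebra p) D.X).IsPrincipal :=
    charIdeal_isPrincipal_holds p D.X
  obtain ⟨fE, hfE⟩ := Submodule.IsPrincipal.principal
    (Literature.NumberTheory.EllipticCurves.Module.charIdeal (IwasawaAlgebra p) D.X)
  have hchar : D.charIdeal = Ideal.span {fE} := hfE
  obtain ⟨L, hL⟩ := exists_isSplitMultPAdicLFunctionOf hsplit Dm.isNewformOf
  -- `ϖ·L = ι(T·g)`, `g = h·fE`
  obtain ⟨g, hgmem, hιg⟩ := hKs hsplit L hL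
  have hgmem' : g ∈ Ideal.span {fE} := by rw [← hchar]; exact hgmem
  obtain ⟨h, hgh⟩ := Ideal.mem_span_singleton'.mp hgmem'
  have hG : iwasawaToPowerSeries p (PowerSeries.X * (h * fE)) =
      PowerSeries.C ((ϖ : ℚ) : ℚ_[p]) * L := by rw [hgh]; exact hιg
  -- the two certificates: `μ(T·h·fE) = 0`, `λ(T·h·fE) = 2`
  obtain ⟨k', hk'⟩ := hμ0 Dm.f Dm.isNewformOf ϖ hϖ L (fun _ ↦ hL) (fun hns ↦ absurd hsplit hns)
  have hL0 : PowerSeries.C ((ϖ : ℚ) : ℚ_[p]) * L ≠ 0 := ne_zero_of_lt_norm_coeff hk'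
  rw [← hG] at hk'
  have hμG : mu (PowerSeries.X * (h * fE)) = 0 := Nat.le_zero.mp (mu_le_of_lt_norm_coeff hk')
  have hlG : lam (PowerSeries.X * (h * fE)) = 1 + 1 :=
    hlam Dm.f Dm.isNewformOf ϖ hϖ L (fun _ ↦ hL) (fun hns ↦ absurd hsplit hns) _ hG
  have hG0 : PowerSeries.X * (h * fE) ≠ 0 := by
    intro h0; apply hL0; rw [← hG, h0, map_zero]
  have hh0 : h ≠ 0 := fun h0 ↦ hG0 (by rw [h0, zero_mul, mul_zero])
  have hfE0 : fE ≠ 0 := fun h0 ↦ hG0 (by rw [h0, mul_zero, mul_zero])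
  -- Gross–Zagier–Kolyvagin: `rank E(ℚ) = 1`
  obtain ⟨hrank, -⟩ := hGZK W hr.le
  have hr1 : W.mordellWeilRank = 1 := hrank.trans hr
  -- Jones (SW Thm. 6.1, split) at `(D, fE, Dh)`
  obtain ⟨hS1, hS2, hS3⟩ := hJs W p hp2 Dq κ γ hκ hγ hγ' D hX fE hchar Dh hDh
  rw [hr1] at hS1 hS2 hS3
  have h1le : 1 ≤ lam fE := by
    have e : ((1 : ℕ) : ℕ∞) ≤ (lam fE : ℕ∞) := hS1.trans (order_le_lam hfE0)
    exact_mod_cast e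
  -- the squeeze: `λ(fE) = 1`, `μ(fE) = 0`; hence `ord_T fE = 1 = rank`
  obtain ⟨-, hlamfE, hμfE⟩ :=
    isUnit_of_lam_mul_mul_eq_of_le PowerSeries.X_ne_zero hh0 hfE0 lam_X hμG hlG h1le
  have hordfE : fE.order = ((1 : ℕ) : ℕ∞) := order_eq_one_of_lam_eq_one hfE0 hlamfE hS1
  -- clause (2): the height is non-degenerate and `Ш[p^∞]` finite; clause (3): the leading term
  obtain ⟨hSch, hfin⟩ := hS2.mp hordfE
  obtain ⟨u, hu⟩ := hS3 hSch hfin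
  haveI := hfin
  refine ⟨hSch, ?_⟩
  -- valuations of the factors
  obtain ⟨hc0, hcval⟩ := valuation_coeff_one_eq_zero hfE0 hlamfE hμfE
  obtain ⟨hlog0, hlogv⟩ := valuation_padicLog_cyclotomicGenerator (p := p) hp2
  set T : ℚ_[p] := (W.torsionOrder : ℚ_[p]) with hT
  set S : ℚ_[p] := (Nat.card (AddCommGroup.primaryComponent W.sha p) : ℚ_[p]) with hS
  set Cv : ℚ_[p] := (W.tamagawaProduct : ℚ_[p]) with hCv
  have hT0 : T ≠ 0 := by rw [hT]; exact_mod_cast (W.torsionOrder_pos_holds).ne'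
  have hS0 : S ≠ 0 := by rw [hS]; exact_mod_cast Nat.card_pos.ne'
  have hCv0 : Cv ≠ 0 := by rw [hCv]; exact_mod_cast (W.tamagawaProduct_pos').ne'
  have h𝓛0 : LInvariant Dq ≠ 0 := LInvariant_ne_zero_holds Dq
  have hRg0 : padicRegulator Dh ≠ 0 := hSch
  have hvT : T.valuation = (padicValNat p W.torsionOrder : ℤ) := by rw [hT, Padic.valuation_natCast]
  have hvC : Cv.valuation = (padicValNat p W.tamagawaProduct : ℤ) := by
    rw [hCv, Padic.valuation_natCast]
  have hvS : S.valuation = (padicValNat p (Nat.card (AddCommGroup.primaryComponent W.sha p)) : ℤ) := by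
    rw [hS, Padic.valuation_natCast]
  -- take valuations in `c1 · lg² · T² = u · (𝓛 · (S · Reg · Cv))`
  have hval := congrArg Padic.valuation hu
  rw [Padic.valuation_mul (mul_ne_zero hc0 (pow_ne_zero _ hlog0)) (pow_ne_zero 2 hT0),
    Padic.valuation_mul hc0 (pow_ne_zero _ hlog0), Padic.valuation_pow, Padic.valuation_pow,
    Padic.valuation_mul (coe_units_ne_zero p u)
      (mul_ne_zero h𝓛0 (mul_ne_zero (mul_ne_zero hS0 hRg0) hCv0)),
    valuation_coe_units_eq_zero, zero_add,
    Padic.valuation_mul h𝓛0 (mul_ne_zero (mul_ne_zero hS0 hRg0) hCv0),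
    Padic.valuation_mul (mul_ne_zero hS0 hRg0) hCv0, Padic.valuation_mul hS0 hRg0,
    hcval, hlogv, hvT, hvC, hvS] at hval
  push_cast at hval ⊢
  linarith

/-- **NON-SPLIT multiplicative `p`: `μ_an = 0 ∧ λ_an = 1` at a rank-one pair ⇒ Schneider's conjecture
for THE Stein–Wuthrich §4.2 height (formula (4.1)) and the exact `Ш`-valuation identity**
`ord_p #Ш(E/ℚ)[p^∞] + ord_p Reg_p(E,Dh) + ord_p ∏c_ℓ = 1 + 2·ord_p #E(ℚ)_tors` (`ε_p = 2 ∈ ℤ_pˣ`).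
Data as in the split case with the Tate parameter `q` given by its defining properties and
`IsMultCanonical Dh q`; facts `hWu`, `hJn` (SW Thm. 6.1 non-split), `hGZK`, `hpar`.
[cite: SteinWuthrich2013, Thm. 6.1 (p. 20), §3.1 (p. 9), §4.2 (p. 15), §4.4 (p. 18)]
[cite: Wuthrich2014, Thm. 16 and §5 (p. 397)] [cite: GreenbergVatsal2000, p. 4 (after Thm. (1.2))]
[cite: Schneider1982PadicHeightI, §1] -/
theorem schneider_and_shaIdentity_of_lamMin_nonsplit
    (hWu : thm16_charIdeal_dvd_multiplicative_of_reducible) (hJn : thm61_nonsplitMultiplicative)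
    (hGZK : rank_eq_analyticRank_of_analyticRank_le_one) (hpar : nonempty_modularParametrizationData)
    (W : WeierstrassCurve ℚ) [W.IsElliptic] [W.IsGloballyMinimal] (p : ℕ) [Fact p.Prime]
    (hp2 : p ≠ 2) (hmult : W.HasMultiplicativeReductionAtPrime p)
    (hns : ¬ W.HasSplitMultiplicativeReductionAtPrime p)
    (hred : ¬ W.HasIrreducibleModPGaloisRep p) (hr : W.analyticRank = 1)
    {q : ℚ_[p]} (hq0 : q ≠ 0) (hq1 : ‖q‖ < 1) (hqj : tateJ q = (W.j : ℚ_[p]))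
    {Dh : PAdicHeightData W p} (hDh : IsMultCanonical Dh q)
    (hμ0 : AnalyticMuLE W p 0) (hlam : AnalyticLambdaEq W p 1) :
    SchneiderConjecture Dh ∧
      (padicValNat p (Nat.card (AddCommGroup.primaryComponent W.sha p)) : ℤ) +
          (padicRegulator Dh).valuation + padicValNat p W.tamagawaProduct =
        1 + 2 * padicValNat p W.torsionOrder := by
  have hpP : p.Prime := Fact.out
  obtain ⟨κ, hκ, γ, hγ, hγ'⟩ := exists_isCyclotomic_isTopGenerator_isCyclotomicVariable_holds p
  obtain ⟨D⟩ := W.nonempty_selmerDualData_holds κ γ hγ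
  haveI : NeZero (W.conductorNorm ℤ) := ⟨(W.conductorNorm_pos_holds).ne'⟩
  obtain ⟨Dm⟩ := hpar W
  obtain ⟨ϖ, -, hϖ, -⟩ := Dm.exists_rat_mul_realPeriodRat_eq_plusPeriod
  haveI : Module.Finite (IwasawaAlgebra p) D.X := D.module_finite_holds hγ
  obtain ⟨hX, hKns, -⟩ := hWu W p hp2 hmult hred hκ hγ hγ' Dm.isNewformOf D ϖ hϖ
  haveI : (Literature.NumberTheory.EllipticCurves.Module.charIdeal (IwasawaAlgebra p) D.X).IsPrincipal :=
    charIdeal_isPrincipal_holds p D.X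
  obtain ⟨fE, hfE⟩ := Submodule.IsPrincipal.principal
    (Literature.NumberTheory.EllipticCurves.Module.charIdeal (IwasawaAlgebra p) D.X)
  have hchar : D.charIdeal = Ideal.span {fE} := hfE
  obtain ⟨L, hL⟩ := exists_isMultPAdicLFunctionOf_neg_one_of_nonsplit Dm.isNewformOf hmult hns
  -- `ϖ·L = ι(g)`, `g = h·fE`
  obtain ⟨g, hgmem, hιg⟩ := hKns hns L hL
  have hgmem' : g ∈ Ideal.span {fE} := by rw [← hchar]; exact hgmem
  obtain ⟨h, hgh⟩ := Ideal.mem_span_singleton'.mp hgmem'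
  have hG : iwasawaToPowerSeries p (1 * (h * fE)) = PowerSeries.C ((ϖ : ℚ) : ℚ_[p]) * L := by
    rw [one_mul, hgh]; exact hιg
  obtain ⟨k', hk'⟩ := hμ0 Dm.f Dm.isNewformOf ϖ hϖ L (fun hs ↦ absurd hs hns) (fun _ ↦ hL)
  have hL0 : PowerSeries.C ((ϖ : ℚ) : ℚ_[p]) * L ≠ 0 := ne_zero_of_lt_norm_coeff hk'
  rw [← hG] at hk'
  have hμG : mu (1 * (h * fE)) = 0 := Nat.le_zero.mp (mu_le_of_lt_norm_coeff hk')
  have hlG : lam (1 * (h * fE)) = 0 + 1 :=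
    hlam Dm.f Dm.isNewformOf ϖ hϖ L (fun hs ↦ absurd hs hns) (fun _ ↦ hL) _ hG
  have hG0 : (1 : IwasawaAlgebra p) * (h * fE) ≠ 0 := by
    intro h0; apply hL0; rw [← hG, h0, map_zero]
  have hh0 : h ≠ 0 := fun h0 ↦ hG0 (by rw [h0, zero_mul, mul_zero])
  have hfE0 : fE ≠ 0 := fun h0 ↦ hG0 (by rw [h0, mul_zero, mul_zero])
  obtain ⟨hrank, -⟩ := hGZK W hr.le
  have hr1 : W.mordellWeilRank = 1 := hrank.trans hr
  obtain ⟨hS1, hS2, hS3⟩ := hJn W p hp2 hmult hns q hq0 hq1 hqj κ γ hκ hγ hγ' D hX fE hchar Dh hDh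
  rw [hr1] at hS1 hS2 hS3
  have h1le : 1 ≤ lam fE := by
    have e : ((1 : ℕ) : ℕ∞) ≤ (lam fE : ℕ∞) := hS1.trans (order_le_lam hfE0)
    exact_mod_cast e
  obtain ⟨-, hlamfE, hμfE⟩ := isUnit_of_lam_mul_mul_eq_of_le one_ne_zero hh0 hfE0
    (lam_eq_zero_of_isUnit isUnit_one) hμG hlG h1le
  have hordfE : fE.order = ((1 : ℕ) : ℕ∞) := order_eq_one_of_lam_eq_one hfE0 hlamfE hS1
  obtain ⟨hSch, hfin⟩ := hS2.mp hordfE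
  obtain ⟨u, hu⟩ := hS3 hSch hfin
  haveI := hfin
  refine ⟨hSch, ?_⟩
  obtain ⟨hc0, hcval⟩ := valuation_coeff_one_eq_zero hfE0 hlamfE hμfE
  obtain ⟨hlog0, hlogv⟩ := valuation_padicLog_cyclotomicGenerator (p := p) hp2
  set T : ℚ_[p] := (W.torsionOrder : ℚ_[p]) with hT
  set S : ℚ_[p] := (Nat.card (AddCommGroup.primaryComponent W.sha p) : ℚ_[p]) with hS
  set Cv : ℚ_[p] := (W.tamagawaProduct : ℚ_[p]) with hCv
  have hT0 : T ≠ 0 := by rw [hT]; exact_mod_cast (W.torsionOrder_pos_holds).ne'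
  have hS0 : S ≠ 0 := by rw [hS]; exact_mod_cast Nat.card_pos.ne'
  have hCv0 : Cv ≠ 0 := by rw [hCv]; exact_mod_cast (W.tamagawaProduct_pos').ne'
  have h20 : (2 : ℚ_[p]) ≠ 0 := two_ne_zero
  have hRg0 : padicRegulator Dh ≠ 0 := hSch
  have hvT : T.valuation = (padicValNat p W.torsionOrder : ℤ) := by rw [hT, Padic.valuation_natCast]
  have hvC : Cv.valuation = (padicValNat p W.tamagawaProduct : ℤ) := by
    rw [hCv, Padic.valuation_natCast]
  have hvS : S.valuation = (padicValNat p (Nat.card (AddCommGroup.primaryComponent W.sha p)) : ℤ) := by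
    rw [hS, Padic.valuation_natCast]
  -- take valuations in `c1 · lg · T² = u · (2 · (S · Reg · Cv))`
  have hval := congrArg Padic.valuation hu
  rw [pow_one, Padic.valuation_mul (mul_ne_zero hc0 hlog0) (pow_ne_zero 2 hT0),
    Padic.valuation_mul hc0 hlog0, Padic.valuation_pow,
    Padic.valuation_mul (coe_units_ne_zero p u)
      (mul_ne_zero h20 (mul_ne_zero (mul_ne_zero hS0 hRg0) hCv0)),
    valuation_coe_units_eq_zero, zero_add,
    Padic.valuation_mul h20 (mul_ne_zero (mul_ne_zero hS0 hRg0) hCv0),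
    Padic.valuation_mul (mul_ne_zero hS0 hRg0) hCv0, Padic.valuation_mul hS0 hRg0,
    valuation_two_eq_zero hp2, hcval, hlogv, hvT, hvC, hvS] at hval
  push_cast at hval ⊢
  linarith

end LamMin

/-! ## §3. A-priori bounds on the regulator valuation -/

section Bounds

variable {W : WeierstrassCurve ℚ} [W.IsElliptic] [W.IsGloballyMinimal] {p : ℕ} [Fact p.Prime]

/-- **A-priori bound at a λ-minimal X2c pair (split `p`)**: `ord_p Reg_p(E,Dh) ≤ 2 + 2·ord_p #tors −
ord_p 𝓛_p − ord_p ∏c_ℓ` (`ord_p #Ш[p^∞] ≥ 0` in the identity). [cite: SteinWuthrich2013, Thm. 6.1 (p. 20)] -/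
theorem regulatorValuation_le_of_lamMin_split
    (hWu : thm16_charIdeal_dvd_multiplicative_of_reducible) (hJs : thm61_splitMultiplicative)
    (hGZK : rank_eq_analyticRank_of_analyticRank_le_one) (hpar : nonempty_modularParametrizationData)
    (W : WeierstrassCurve ℚ) [W.IsElliptic] [W.IsGloballyMinimal] (p : ℕ) [Fact p.Prime]
    (hp2 : p ≠ 2) (hred : ¬ W.HasIrreducibleModPGaloisRep p) (hr : W.analyticRank = 1)
    (Dq : TateParameterData W p) {Dh : PAdicHeightData W p} (hDh : IsSplitMultCanonical Dh Dq)
    (hμ0 : AnalyticMuLE W p 0) (hlam : AnalyticLambdaEq W p 2) :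
    (padicRegulator Dh).valuation ≤ 2 + 2 * (padicValNat p W.torsionOrder : ℤ) -
        (LInvariant Dq).valuation - padicValNat p W.tamagawaProduct := by
  obtain ⟨-, hid⟩ := schneider_and_shaIdentity_of_lamMin_split hWu hJs hGZK hpar W p hp2 hred hr Dq
    hDh hμ0 hlam
  have h0 : (0 : ℤ) ≤ padicValNat p (Nat.card (AddCommGroup.primaryComponent W.sha p)) := by
    exact_mod_cast Nat.zero_le _
  linarith

/-- **A-priori bound at a λ-minimal X2c pair (non-split `p`)**: `ord_p Reg_p(E,Dh) ≤ 1 + 2·ord_p #tors −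
ord_p ∏c_ℓ`. [cite: SteinWuthrich2013, Thm. 6.1 (p. 20)] -/
theorem regulatorValuation_le_of_lamMin_nonsplit
    (hWu : thm16_charIdeal_dvd_multiplicative_of_reducible) (hJn : thm61_nonsplitMultiplicative)
    (hGZK : rank_eq_analyticRank_of_analyticRank_le_one) (hpar : nonempty_modularParametrizationData)
    (W : WeierstrassCurve ℚ) [W.IsElliptic] [W.IsGloballyMinimal] (p : ℕ) [Fact p.Prime]
    (hp2 : p ≠ 2) (hmult : W.HasMultiplicativeReductionAtPrime p)
    (hns : ¬ W.HasSplitMultiplicativeReductionAtPrime p)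
    (hred : ¬ W.HasIrreducibleModPGaloisRep p) (hr : W.analyticRank = 1)
    {q : ℚ_[p]} (hq0 : q ≠ 0) (hq1 : ‖q‖ < 1) (hqj : tateJ q = (W.j : ℚ_[p]))
    {Dh : PAdicHeightData W p} (hDh : IsMultCanonical Dh q)
    (hμ0 : AnalyticMuLE W p 0) (hlam : AnalyticLambdaEq W p 1) :
    (padicRegulator Dh).valuation ≤ 1 + 2 * (padicValNat p W.torsionOrder : ℤ) -
        padicValNat p W.tamagawaProduct := by
  obtain ⟨-, hid⟩ := schneider_and_shaIdentity_of_lamMin_nonsplit hWu hJn hGZK hpar W p hp2 hmult hns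
    hred hr hq0 hq1 hqj hDh hμ0 hlam
  have h0 : (0 : ℤ) ≤ padicValNat p (Nat.card (AddCommGroup.primaryComponent W.sha p)) := by
    exact_mod_cast Nat.zero_le _
  linarith

end Bounds

end Summit.BirchSwinnertonDyer.Rank1Residual.X2

end
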